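import Literature.IUT.HodgeArakelov.IotaInvariantThetaInftyHoldsOfYcl
import Literature.IUT.HodgeArakelov.MonoThetaProjectiveBridgeEtTh
import Literature.AnabelianGeometry.EtaleTheta.Discharge.Sec1CyclotomeModOfTate

/-!
# [IUTchII] Prop 2.2 (ii) «respectively» clause AT THE MODEL — the cyclotome-tower DATUM (GAP-LEDGER G-L2t10-1)
# ELIMINATED: the clause holds modulo the ORIGIN CLAUSES of the [EtTh] §1 setting, `hYcl`, and [EtTh] Prop. 1.5 (iii)

S. Mochizuki, *Inter-universal Teichmüller theory II*, kurims manuscript (Dec. 2020), §2 Prop. 2.2 (ii) p. 66 l. 56–61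
(«determines a specific … `μ`-orbit … `∞θ^ι(Π_v) ⊆ ∞θ(Π_v)` within each `{(l·ℤ) × μ}`-orbit») [claim: Mochizuki2012, status: disputed];
*The étale theta function …* [EtTh] §1 pp. 12–13 («`(Ẑ(1) ≅) Δ_Θ`», «`(Δ^tp_Y)^ell ≅ Ẑ(1)`», and the printed exact sequence
«`1 → (Δ^tp_Y)^ell ⊗ ℤ/Nℤ → Gal(Y_N/Y) → Gal(K_N/K) → 1`» of p. 13 defining the covering `Y_N → Y`; the level-`N` shorthand
`Δ^tp_Y/Δ^tp_{Y_N} ≅ ℤ/Nℤ(1)` used by this lineage is DERIVED from these — our paraphrase of the geometric part of that sequence,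
not a printed formula) [cite: MochizukiEtTh2009, §1 p.12].  abc-iut cell, layer L6,
node **IUTchII:Prop2.2(ii)**, sub-DAG row Prop-22.ii.r13a (seat abc-iut-w5-d187, gen 3; doc-only re-label of the third fragment,
gen 8, referee lane P31 2026-08-27).  PROOF-ONLY; no definition; nothing of another seat's file is restated.

THE SITUATION.  This lineage's capstone at the model, `inftyClause_of_cyclotomeTower_of_prop15iii_of_thm16Origin`
(`IotaInvariantThetaInftyHoldsOfYcl.lean`, p427268), proves the clause modulo {`IsEtThOrigin` (F-2498), `IsThm16Origin` (R3),
§6 `GroupLevelData`, `hYcl` (G-w4d021-2), a cyclotome tower `τ : D.CyclotomeTower l Es` (GAP-LEDGER G-L2t10-1, DATA),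
`Prop15iii` (F-0591)}.  This seat's `Discharge/Sec1CyclotomeModOfTate.lean` CONSTRUCTS the tower — at every cofinal chain — from
the Tate-module clauses `IsTateOrigin` (abc-iut-w5-d051) together with the same origin inputs (`nonempty_cyclotomeTower_of_origins`).
THIS FILE composes: **`inftyClause_of_origins_of_prop15iii`** — the «respectively» clause of [IUTchII] Prop. 2.2 (ii) holds for every
`IotaInvariantTheta'` datum over `D := etaleThetaDataOfSetting'`, modulo ONLY {`IsEtThOrigin` (F-2498), `IsThm16Origin`, `IsTateOrigin`,
§6 `GroupLevelData`, `hYcl` (G-w4d021-2), `Prop15iii` (F-0591)} + the typed §1/§2 hypothesis packages `Compat`/`Sec2Hyps`/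
`PiYddCharacteristic`: NO data binder from GAP-LEDGER remains in the row (G-w5d187-1 and G-L2t10-1 both eliminated).  Likewise
`hdiv_of_origins_of_prop15iii` ((hdiv) at the model) and `nonempty_cyclotomeTower_chainSet_of_origins` (the tower over
abc-iut-w4-d043's chain `chainSet M M'`, the shape the L6 Cor 1.12 / Prop 3.1 model chains consume).  Typed ≠ proved for the
residual named inputs; nothing of [IUTchII]/[EtTh] is asserted; no side is taken on [IUTchIII] Cor. 3.12.
-/

namespace Literature.IUT.HodgeArakelov

open Literature.AnabelianGeometry.EtaleTheta Literature.AnabelianGeometry.SemiGraphs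
open EtaleThetaDataOfSetting _root_.Topology

noncomputable section

namespace EtaleThetaDataOfSetting

variable {p : ℕ} [Fact p.Prime] {D : Literature.AnabelianGeometry.EtaleTheta.ThetaSetting p}
  {E : D.EtaleThetaData} {l : ℕ} (C : E.DoubleUnderline l)

/-- **A cyclotome tower over abc-iut-w4-d043's chain `chainSet M M'` from the origin clauses** (for the L6 model chains of
[IUTchII] Cor. 1.12 / Prop. 3.1 (ii), which run along `chainSet`): `IsEtThOrigin` + `IsThm16Origin` + `IsTateOrigin` + §6 bundle +
`hYcl` + `l ≠ 0`. [cite: MochizukiEtTh2009, §1 p.13] -/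
theorem nonempty_cyclotomeTower_chainSet_of_origins (hO : D.IsEtThOrigin) (h16 : D.IsThm16Origin)
    (hT : D.IsTateOrigin) (d : D.toTemperedCurve.GroupLevelData)
    (hYcl : (D.DtpY.map D.toHat.toMonoidHom).topologicalClosure ≤
      D.DtpY.map D.toHat.toMonoidHom ⊔ (⁅⁅D.DeltaHat, D.DeltaHat⁆, D.DeltaHat⁆).topologicalClosure)
    (hl : l ≠ 0) {M M' : ℕ+} (h : (M : ℕ) ∣ (M' : ℕ)) :
    Nonempty (D.CyclotomeTower l (EtaleLevels.chainSet M M')) :=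
  D.nonempty_cyclotomeTower_of_origins hO h16 hT d hYcl hl (EtaleLevels.one_mem_chainSet M M')
    (EtaleLevels.chainSet_cofinal M M') (EtaleLevels.chainSet_total h)

/-- **(hdiv) at the model from the origin clauses and [EtTh] Prop. 1.5 (iii)** — `hdiv_of_cyclotomeTower_of_prop15iii_of_hYcl`
with the tower SUPPLIED by `nonempty_cyclotomeTower_of_origins`; `l ≠ 0` comes from the double-underline datum.
[claim: Mochizuki2012, status: disputed] (IUTchII §2 Prop 2.2 (ii), kurims p.66) -/
theorem hdiv_of_origins_of_prop15iii (hO : D.IsEtThOrigin) (h16 : D.IsThm16Origin) (hT : D.IsTateOrigin)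
    (d : D.toTemperedCurve.GroupLevelData)
    (hYcl : (D.DtpY.map D.toHat.toMonoidHom).topologicalClosure ≤
      D.DtpY.map D.toHat.toMonoidHom ⊔ (⁅⁅D.DeltaHat, D.DeltaHat⁆, D.DeltaHat⁆).topologicalClosure)
    (hC : D.Compat) (hS : D.Sec2Hyps) (h15 : ThetaSetting.Prop15iii E hC) (hchar : PiYddCharacteristic C)
    (S : BadPlaceSetting.{0}) (eS : (Pi C) ≃ₜ* S.PiX) (hl : S.l = l) :
    ∀ t ∈ (etaleThetaDataOfSetting' C hC hS hchar S.toThetaSetting eS hl).theta, ∀ N : ℕ, 0 < N →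
      ∃ x : (coh C).lim, N • x = (coh C).toLim ⊤ t := by
  haveI := d.secondCountableTopology
  obtain ⟨τ⟩ := nonempty_cyclotomeTower_chainSet_of_origins (l := l) hO h16 hT d hYcl C.l_ne_zero
    (dvd_refl ((1 : ℕ+) : ℕ))
  exact hdiv_of_cyclotomeTower_of_prop15iii_of_hYcl C hO d.isTempered hYcl h16.isQuotientMap_toTheta τ hC hS h15
    hchar S eS hl

/-- **IUTchII:Prop2.2(ii) «respectively» clause AT THE MODEL from the ORIGIN CLAUSES** — `InftyClause` holds for every
`IotaInvariantTheta'` datum over `D := etaleThetaDataOfSetting'`, modulo ONLY: `IsEtThOrigin` (F-2498), `IsThm16Origin`,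
`IsTateOrigin`, the §6 parameter bundle, `hYcl` (G-w4d021-2), `Prop15iii` (F-0591) — the cyclotome-tower datum (G-L2t10-1) and the
compactness binder (G-w5d187-1) are THEOREMS here. [claim: Mochizuki2012, status: disputed] (IUTchII §2 Prop 2.2 (ii), kurims p.66) -/
theorem inftyClause_of_origins_of_prop15iii (hO : D.IsEtThOrigin) (h16 : D.IsThm16Origin) (hT : D.IsTateOrigin)
    (d : D.toTemperedCurve.GroupLevelData)
    (hYcl : (D.DtpY.map D.toHat.toMonoidHom).topologicalClosure ≤
      D.DtpY.map D.toHat.toMonoidHom ⊔ (⁅⁅D.DeltaHat, D.DeltaHat⁆, D.DeltaHat⁆).topologicalClosure)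
    (hC : D.Compat) (hS : D.Sec2Hyps) (h15 : ThetaSetting.Prop15iii E hC) (hchar : PiYddCharacteristic C)
    (S : BadPlaceSetting.{0}) (eS : (Pi C) ≃ₜ* S.PiX) (hl : S.l = l) {T : TemperedCoverings S (Pi C)}
    {Dec : SubgraphDecomposition S T (etaleThetaDataOfSetting' C hC hS hchar S.toThetaSetting eS hl)}
    (Θ : IotaInvariantTheta' Dec) : Θ.InftyClause := by
  obtain ⟨τ⟩ := nonempty_cyclotomeTower_chainSet_of_origins (l := l) hO h16 hT d hYcl C.l_ne_zero
    (dvd_refl ((1 : ℕ+) : ℕ))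
  exact inftyClause_of_cyclotomeTower_of_prop15iii_of_thm16Origin C hO h16 d hYcl τ hC hS h15 hchar S eS hl Θ

end EtaleThetaDataOfSetting

end

end Literature.IUT.HodgeArakelov
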